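import Mathlib
import Summits.Ventures.HodgeRepro2.Tier7.Line3.TorusSupport

/-!
# Tier7/Line3/TorusCompact — the two tori are COMPACT over a proper normed field with an isometric involution
(seat t7-x1, gen 3; the `CompactSpace A` hypothesis of LevelFactorPositive p691647 / LevelFactorOfLocal p693983 for p1's
first torus, built in TorusSupport p695064)

LINE 3 (t7-plan-3), version (ii). At the inert `v₁` the tori are compact (`E¹_{v₁}` is compact); LevelFactorPositive takes
`[CompactSpace A] [CompactSpace B]`. For the diagonal torus `torusA σ ≤ Fin 2 → Fˣ` of TorusSupport this is a theorem
over a normed field `F` that is a PROPER space (a local field: closed bounded sets are compact) with an involution `σ`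
that is continuous and norm-preserving: the coercion `Fˣ → F` is a topological embedding (`Units.isEmbedding_val₀`,
continuous inversion off `0`), so `torusA σ` is compact iff its image `{a : Fin 2 → F | ∀ i, N(a i) = 1}` is
(`IsInducing.isCompact_iff` through `Pi.map`); that image is CLOSED (the preimage of `{1}` under the continuous
`a ↦ a i · σ(a i)`, for each `i`) and BOUNDED (`N(a i) = 1` and `‖σ x‖ = ‖x‖` give `‖a i‖ = 1`), hence compact
(`Metric.isCompact_of_isClosed_isBounded`). `compactSpace_torusA`. The second torus `torusB σ f` (acting on the basis
`f`) is the IMAGE of the first under the continuous conjugation `b ↦ P · diag(b) · P⁻¹` when the columns of the unit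
`P ∈ GL₂(F)` are the basis `f` (`torusB_eq_image`: `conjDiag P b` acts on `f` by `b` — `P⁻¹ f_j = e_j`,
`diag(b) e_j = b_j e_j`, `P e_j = f_j` — and conversely `t f_j = b_j f_j` forces `t P = P diag(b)`, i.e.
`t = P diag(b) P⁻¹`), hence compact as a continuous image (`isCompact_torusB`, `compactSpace_torusB`). With
LevelTowerTopology (open levels) and CongruenceSubgroup (antitone, `⋂ = {1}`, normalised), every topological hypothesis
of LevelFactorPositive is a theorem for the concrete model; the Haar measures of the compact tori are Mathlib's
(finite and open-positive by instance).
DICTIONARY (in words): `F = E_{v₁}` (locally compact ⇒ `ProperSpace`), `σ` the involution of `E_{v₁}/F_{v₁}` (an isometry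
for the unique extension of `|·|_{v₁}`). Nothing here is about (N), (P), the real `X`, or HC_CM; §8(d): NO.
Blind lane: Mathlib + the HodgeRepro2 prefix; no sorry; axioms ⊆ {propext, Classical.choice, Quot.sound}.
-/

namespace Summit.Ventures.HodgeRepro2.Tier7.Line3.TorusCompact

open Matrix Summit.Ventures.HodgeRepro2.T7SupportTwoTorusInvariant
  Summit.Ventures.HodgeRepro2.Tier7.Line3.TorusSupport Topology

variable {F : Type*} [NormedField F] (σ : F →+* F)

/-- the norm-one set in `Fin 2 → F`: the image of the diagonal torus. -/
def normOneSet : Set (Fin 2 → F) := {a | ∀ i, nrm σ (a i) = 1}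

/-- an element of norm one (for an isometric involution) has `‖x‖ = 1`. -/
theorem norm_eq_one_of_nrm_eq_one (hσn : ∀ x, ‖σ x‖ = ‖x‖) {x : F} (hx : nrm σ x = 1) : ‖x‖ = 1 := by
  have h : ‖x‖ * ‖x‖ = 1 := by
    have := congrArg norm hx
    rw [nrm, norm_mul, hσn, norm_one] at this
    exact this
  have h0 : 0 ≤ ‖x‖ := norm_nonneg x
  nlinarith [h, h0]

/-- the norm-one set is closed (continuous `σ`). -/
theorem isClosed_normOneSet (hσc : Continuous σ) : IsClosed (normOneSet σ : Set (Fin 2 → F)) := by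
  have hset : (normOneSet σ : Set (Fin 2 → F)) = ⋂ i, (fun a : Fin 2 → F => nrm σ (a i)) ⁻¹' {1} := by
    ext a
    simp [normOneSet, Set.mem_iInter]
  rw [hset]
  refine isClosed_iInter fun i => isClosed_singleton.preimage ?_
  unfold nrm
  exact (continuous_apply i).mul (hσc.comp (continuous_apply i))

/-- the norm-one set is bounded (isometric `σ`). -/
theorem isBounded_normOneSet (hσn : ∀ x, ‖σ x‖ = ‖x‖) :
    Bornology.IsBounded (normOneSet σ : Set (Fin 2 → F)) := by
  refine isBounded_iff_forall_norm_le.2 ⟨1, fun a ha => ?_⟩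
  rw [pi_norm_le_iff_of_nonneg zero_le_one]
  intro i
  exact (norm_eq_one_of_nrm_eq_one σ hσn (ha i)).le

/-- the norm-one set is compact over a proper normed field. -/
theorem isCompact_normOneSet [ProperSpace F] (hσc : Continuous σ) (hσn : ∀ x, ‖σ x‖ = ‖x‖) :
    IsCompact (normOneSet σ : Set (Fin 2 → F)) :=
  Metric.isCompact_of_isClosed_isBounded (isClosed_normOneSet σ hσc) (isBounded_normOneSet σ hσn)

/-- the image of the diagonal torus under the coercion `Fˣ → F` (coordinatewise) is the norm-one set. -/
theorem image_torusA :
    Pi.map (fun _ : Fin 2 => (Units.val : Fˣ → F)) '' (torusA σ : Set (Fin 2 → Fˣ)) = normOneSet σ := by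
  ext a
  constructor
  · rintro ⟨u, hu, rfl⟩
    have hu' : u ∈ Subgroup.pi Set.univ fun _ : Fin 2 => normOne σ := hu
    intro i
    exact (Subgroup.mem_pi Set.univ).1 hu' i (Set.mem_univ i)
  · intro ha
    have ha' : ∀ i, nrm σ (a i) = 1 := ha
    refine ⟨fun i => Units.mk0 (a i) (ne_zero_of_nrm_eq_one σ (ha' i)), ?_, ?_⟩
    · show (fun i => Units.mk0 (a i) (ne_zero_of_nrm_eq_one σ (ha' i))) ∈
        Subgroup.pi Set.univ fun _ : Fin 2 => normOne σ
      rw [Subgroup.mem_pi]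
      intro i _
      show nrm σ ((Units.mk0 (a i) _ : Fˣ) : F) = 1
      rw [Units.val_mk0]
      exact ha' i
    · funext i
      rw [Pi.map_apply, Units.val_mk0]

/-- **the diagonal torus is COMPACT** over a proper normed field with a continuous isometric involution. -/
theorem isCompact_torusA [ProperSpace F] (hσc : Continuous σ) (hσn : ∀ x, ‖σ x‖ = ‖x‖) :
    IsCompact (torusA σ : Set (Fin 2 → Fˣ)) := by
  have hind : IsInducing (Pi.map fun _ : Fin 2 => (Units.val : Fˣ → F)) :=
    IsInducing.piMap fun _ => Units.isEmbedding_val₀.isInducing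
  rw [hind.isCompact_iff, image_torusA]
  exact isCompact_normOneSet σ hσc hσn

/-- `CompactSpace (torusA σ)`: the hypothesis of LevelFactorPositive / LevelFactorOfLocal for the first torus. -/
theorem compactSpace_torusA [ProperSpace F] (hσc : Continuous σ) (hσn : ∀ x, ‖σ x‖ = ‖x‖) :
    CompactSpace (torusA σ) :=
  isCompact_iff_compactSpace.1 (isCompact_torusA σ hσc hσn)


/-! ## The second torus: the image of the norm-one scalars under `b ↦ P · diag(b) · P⁻¹` -/

section TorusB

/-- `diagUnitHom` is continuous (both the matrix and its inverse are diagonals of continuous entries). -/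
theorem continuous_diagUnitHom : Continuous (diagUnitHom : (Fin 2 → Fˣ) → GL (Fin 2) F) := by
  rw [Units.continuous_iff]
  constructor
  · show Continuous fun b : Fin 2 → Fˣ => diagonal fun i => ((b i : Fˣ) : F)
    exact Continuous.matrix_diagonal (continuous_pi fun i => Units.continuous_val.comp (continuous_apply i))
  · show Continuous fun b : Fin 2 → Fˣ => diagonal fun i => (((b i)⁻¹ : Fˣ) : F)
    exact Continuous.matrix_diagonal
      (continuous_pi fun i => Units.continuous_val.comp (continuous_inv.comp (continuous_apply i)))

variable (f : Fin 2 → Fin 2 → F) (P : GL (Fin 2) F)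

/-- the conjugation `b ↦ P · diag(b) · P⁻¹`. -/
def conjDiag (b : Fin 2 → Fˣ) : GL (Fin 2) F := P * diagUnitHom b * P⁻¹

/-- `conjDiag` is continuous. -/
theorem continuous_conjDiag : Continuous (conjDiag P) :=
  (continuous_const.mul continuous_diagUnitHom).mul continuous_const

/-- the columns of `P` are the basis `f`: `f j = P *ᵥ e_j`. -/
theorem mulVec_single_eq_of_col (hP : ∀ j, (P : Matrix (Fin 2) (Fin 2) F).col j = f j) (j : Fin 2) :
    (P : Matrix (Fin 2) (Fin 2) F) *ᵥ Pi.single j (1 : F) = f j := by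
  rw [mulVec_single_one, hP]

/-- `P⁻¹ *ᵥ f j = e_j`. -/
theorem inv_mulVec_eq_single (hP : ∀ j, (P : Matrix (Fin 2) (Fin 2) F).col j = f j) (j : Fin 2) :
    ((P⁻¹ : GL (Fin 2) F) : Matrix (Fin 2) (Fin 2) F) *ᵥ f j = Pi.single j (1 : F) := by
  rw [← mulVec_single_eq_of_col f P hP j, mulVec_mulVec, Units.inv_mul, one_mulVec]

/-- `conjDiag P b` acts on `f` by the scalars `b`. -/
theorem actsOn_conjDiag (hP : ∀ j, (P : Matrix (Fin 2) (Fin 2) F).col j = f j) (b : Fin 2 → Fˣ) :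
    ActsOn f ((conjDiag P b : GL (Fin 2) F) : Matrix (Fin 2) (Fin 2) F) (fun j => ((b j : Fˣ) : F)) := by
  intro j
  show (((P * diagUnitHom b * P⁻¹ : GL (Fin 2) F)) : Matrix (Fin 2) (Fin 2) F) *ᵥ f j = ((b j : Fˣ) : F) • f j
  rw [Units.val_mul, Units.val_mul, ← mulVec_mulVec, ← mulVec_mulVec, inv_mulVec_eq_single f P hP j]
  show (P : Matrix (Fin 2) (Fin 2) F) *ᵥ (diagonal (fun i => ((b i : Fˣ) : F)) *ᵥ Pi.single j (1 : F))
    = ((b j : Fˣ) : F) • f j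
  rw [diagonal_mulVec_single, mul_one, ← mulVec_single_eq_of_col f P hP j]
  have hs : (Pi.single j ((b j : Fˣ) : F) : Fin 2 → F) = ((b j : Fˣ) : F) • Pi.single j (1 : F) := by
    ext k
    simp [Pi.single_apply]
  rw [hs, mulVec_smul]

/-- an element of the second torus is `P · diag(b) · P⁻¹` for its scalars `b`. -/
theorem eq_conjDiag_of_actsOn (hP : ∀ j, (P : Matrix (Fin 2) (Fin 2) F).col j = f j) (t : GL (Fin 2) F)
    (b : Fin 2 → F) (hb : ∀ j, b j ≠ 0) (h : ActsOn f (t : Matrix (Fin 2) (Fin 2) F) b) :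
    t = conjDiag P fun j => Units.mk0 (b j) (hb j) := by
  have hcol : ∀ j, ((t : Matrix (Fin 2) (Fin 2) F) * (P : Matrix (Fin 2) (Fin 2) F)) *ᵥ Pi.single j (1 : F)
      = ((P : Matrix (Fin 2) (Fin 2) F) * diagonal b) *ᵥ Pi.single j (1 : F) := by
    intro j
    rw [← mulVec_mulVec, mulVec_single_eq_of_col f P hP j, h j, ← mulVec_mulVec, diagonal_mulVec_single,
      mul_one]
    have hs : (Pi.single j (b j) : Fin 2 → F) = b j • Pi.single j (1 : F) := by
      ext k
      simp [Pi.single_apply]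
    rw [hs, mulVec_smul, mulVec_single_eq_of_col f P hP j]
  have hmat : (t : Matrix (Fin 2) (Fin 2) F) * (P : Matrix (Fin 2) (Fin 2) F)
      = (P : Matrix (Fin 2) (Fin 2) F) * diagonal b := by
    ext i j
    have := congrFun (hcol j) i
    rwa [mulVec_single_one, mulVec_single_one] at this
  apply Units.ext
  show (t : Matrix (Fin 2) (Fin 2) F) = (((P * diagUnitHom _ * P⁻¹ : GL (Fin 2) F)) : Matrix (Fin 2) (Fin 2) F)
  rw [Units.val_mul, Units.val_mul]
  have hd : ((diagUnitHom (fun j => Units.mk0 (b j) (hb j)) : GL (Fin 2) F) : Matrix (Fin 2) (Fin 2) F)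
      = diagonal b := rfl
  rw [hd, ← hmat, mul_assoc, Units.mul_inv, mul_one]

/-- **the second torus is the image of the first under the conjugation** `b ↦ P · diag(b) · P⁻¹`. -/
theorem torusB_eq_image (hP : ∀ j, (P : Matrix (Fin 2) (Fin 2) F).col j = f j) :
    (torusB σ f : Set (GL (Fin 2) F)) = conjDiag P '' (torusA σ : Set (Fin 2 → Fˣ)) := by
  ext t
  constructor
  · rintro ⟨b, hb, h⟩
    have hb0 : ∀ j, b j ≠ 0 := fun j => ne_zero_of_nrm_eq_one σ (hb j)
    refine ⟨fun j => Units.mk0 (b j) (hb0 j), ?_, (eq_conjDiag_of_actsOn f P hP t b hb0 h).symm⟩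
    show (fun j => Units.mk0 (b j) (hb0 j)) ∈ Subgroup.pi Set.univ fun _ : Fin 2 => normOne σ
    rw [Subgroup.mem_pi]
    intro j _
    show nrm σ ((Units.mk0 (b j) (hb0 j) : Fˣ) : F) = 1
    rw [Units.val_mk0]
    exact hb j
  · rintro ⟨b, hb, rfl⟩
    have hb' : b ∈ Subgroup.pi Set.univ fun _ : Fin 2 => normOne σ := hb
    refine ⟨fun j => ((b j : Fˣ) : F), fun j => (Subgroup.mem_pi Set.univ).1 hb' j (Set.mem_univ j), ?_⟩
    exact actsOn_conjDiag f P hP b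

/-- **the second torus is COMPACT** (a continuous image of the compact first torus) when the columns of `P` are `f`. -/
theorem isCompact_torusB [ProperSpace F] (hσc : Continuous σ) (hσn : ∀ x, ‖σ x‖ = ‖x‖)
    (hP : ∀ j, (P : Matrix (Fin 2) (Fin 2) F).col j = f j) :
    IsCompact (torusB σ f : Set (GL (Fin 2) F)) := by
  rw [torusB_eq_image σ f P hP]
  exact (isCompact_torusA σ hσc hσn).image (continuous_conjDiag P)

/-- `CompactSpace (torusB σ f)`: the hypothesis of LevelFactorPositive / LevelFactorOfLocal for the second torus. -/
theorem compactSpace_torusB [ProperSpace F] (hσc : Continuous σ) (hσn : ∀ x, ‖σ x‖ = ‖x‖)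
    (hP : ∀ j, (P : Matrix (Fin 2) (Fin 2) F).col j = f j) : CompactSpace (torusB σ f) :=
  isCompact_iff_compactSpace.1 (isCompact_torusB σ f P hσc hσn hP)

end TorusB

end Summit.Ventures.HodgeRepro2.Tier7.Line3.TorusCompact
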